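import Literature.NumberTheory.Sieve.FordMaynardFragmentationBridge

/-!
# Route `FordMaynardNoSieveConst0164`, crux `NegWitness0164` (stmt-Parity-19102), line `birth`,
# stub `stub_tweakNeg0164`: the fragmentation operator at a ONE-component vector

Fourth helper file toward the certificate stub (K. Ford, J. Maynard, *On the theory of prime producing
sieves*, arXiv:2407.14368, §6.1 (6.3) with `m = 1`, and §8, proof of Theorem 2.7 (c): the value
`f(1) = ∑_k (1/k!)… = I₃ + I₅`).  The tree's iterated form `fragOp_eq_multiSlice` specialised to a single
block: for `g` bounded measurable, `η > 0` and `ξ = (ξ₀)`,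

  `fragOp γ η g (ξ₀) = ξ₀ · ∑_{n=1}^{⌊1/η⌋} ∫_{v ∈ (0,∞)^n, |v| = ξ₀} 𝟙[v ≥ η] 𝓛_{1-γ}(v)/(n! v₁⋯vₙ) g(v) dv`,

i.e. `ξ₀ ∑_n sliceIntegral n ξ₀ (v ↦ 𝟙[∀ t, η ≤ v t] · blockWeight γ n v · g n v)`.  With `ξ₀ = 1` this is
the `k = 1` clause `h(1)` of the stub (`tweak_one_eq_fragOp_0164` of the first helper file), whose
`n = 3, 4, 5` terms carry the Linnik weights `2/3!`, `(2 - P)…`, … of the other helper files.  Def-free.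

References: [FordMaynard2024PrimeSieves] arXiv:2407.14368, §6.1 (6.3), §8.
-/

noncomputable section

open Finset MeasureTheory
open scoped Classical
open Literature.NumberTheory.Sieve Literature.NumberTheory.Sieve.FordMaynard

namespace Summit.Parity.GeneralizedHardyLittlewood.FordMaynardNoSieveConst0164NegWitness0164

/-- Sums over `[1, N]^{Fin 1}` are sums over `[1, N]`. [folklore] -/
theorem sum_piFinset_fin_one (T : Finset ℕ) (Φ : (Fin 1 → ℕ) → ℝ) :
    ∑ kv ∈ Fintype.piFinset (fun _ : Fin 1 => T), Φ kv = ∑ n ∈ T, Φ (fun _ => n) := by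
  refine Finset.sum_nbij' (fun kv => kv 0) (fun n => fun _ => n) ?_ ?_ ?_ ?_ ?_
  · intro kv hkv
    exact Fintype.mem_piFinset.1 (Finset.mem_coe.1 hkv) 0
  · intro n hn
    exact Finset.mem_coe.2 (Fintype.mem_piFinset.2 fun _ => Finset.mem_coe.1 hn)
  · intro kv _
    funext i
    exact congrArg kv (Subsingleton.elim 0 i)
  · intro n _
    rfl
  · intro kv _
    congr 1
    funext i
    exact congrArg kv (Subsingleton.elim i 0)

/-- `multiSlice` with one block is a slice integral over that block. [folklore] -/
theorem multiSlice_one (n : ℕ) (ξ : Fin 1 → ℝ) (H : (Fin (bsum 1 (fun _ => n)) → ℝ) → ℝ) :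
    multiSlice 1 (fun _ => n) ξ H = sliceIntegral n (ξ 0) (fun v => H (v ∘ Fin.cast (Nat.zero_add n))) := by
  rw [multiSlice_succ, multiSlice_zero]
  show sliceIntegral n (ξ 0) (fun v => H (Fin.append Fin.elim0 v)) = _
  congr 1
  funext v
  exact congrArg H (Fin.elim0_append v)

/-- **The fragmentation operator at a one-component vector** (`g` bounded measurable, `η > 0`):
`fragOp γ η g (ξ₀) = ξ₀ ∑_{n=1}^{⌊1/η⌋} sliceIntegral n ξ₀ (v ↦ 𝟙[v ≥ η] blockWeight γ n v · g n v)`.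
[cite: FordMaynard2024PrimeSieves, §6.1 (6.3) (m = 1)] -/
theorem fragOp_one_eq_sum_sliceIntegral {γ η : ℝ} (hη : 0 < η) (g : VecFn) (hgm : ∀ n, Measurable (g n))
    {F : ℝ} (hF : ∀ n v, |g n v| ≤ F) (ξ : Fin 1 → ℝ) :
    fragOp γ η g 1 ξ = ξ 0 * ∑ n ∈ Finset.Icc 1 (maxBlock η),
      sliceIntegral n (ξ 0) (fun v => if ∀ t, η ≤ v t then blockWeight γ n v * g n v else 0) := by
  rw [fragOp_eq_multiSlice hη g hgm hF 1 ξ, Fin.prod_univ_one]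
  congr 1
  rw [sum_piFinset_fin_one]
  refine Finset.sum_congr rfl fun n _ => ?_
  rw [multiSlice_one]
  congr 1
  funext v
  -- the support condition, the block weight and the value of `g` read through the casts
  have hcond : (∀ t, η ≤ (v ∘ Fin.cast (Nat.zero_add n)) t) ↔ ∀ t, η ≤ v t := by
    constructor
    · intro h t
      have := h (Fin.cast (Nat.zero_add n).symm t)
      simpa using this
    · intro h t
      exact h _
  split_ifs with hc h h
  · rw [Fin.prod_univ_one]
    refine congrArg₂ (· * ·) (congrArg (blockWeight γ n) (funext fun i => ?_))
      (VecFn.apply_congr g (by simp) _ _ fun i => rfl)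
    simp only [Function.comp_apply]
    congr 1
    ext
    simp only [Fin.val_cast, finSigmaFinEquiv_apply]
    simp
  · exact absurd (hcond.1 hc) h
  · exact absurd (hcond.2 h) hc
  · rfl

end Summit.Parity.GeneralizedHardyLittlewood.FordMaynardNoSieveConst0164NegWitness0164

end
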